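import Mathlib.Analysis.InnerProductSpace.Basic
import Mathlib.Analysis.Calculus.IteratedDeriv.Lemmas
import HarnessLib

/-!
# COERCIVITY FROM GROWTH — GAUGE FORM: `(2μ − 2f₀/R² − 2B₄R²)·N(y) ≤ Q(y)` for any degree-2-homogeneous gauge `N` and quadratic functional `Q`
# (free-hands support of ⟨stmt-QuantumFields-24197⟩ `SwapVirialDeficit.SwapGluedStiffness`; norm-free twin of ✓`QuantitativeLaplace.inner_ge_of_growth_of_taylor_offset`
# for the gnomonic follower fibre `(Fol L → ℝ³)` with `N(y) = Σ_f|y_f|²` and `Q(y) = d²/dt² F̂_z(C, gno⁺(t·y))|₀` — no inner-product packaging, no Riesz operator)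

✓`inner_ge_of_growth_of_taylor_offset` is stated on a real inner-product space with `‖y‖²` and `⟪A y, y⟫`; its proof uses only (i) `‖t•y‖² = t²‖y‖²`,
(ii) `⟪A(t•y), t•y⟫ = t²⟪Ay,y⟫`, (iii) evaluation at `±u`.  This file abstracts exactly that:
* ★★★ `gauge_coercive_of_growth_offset` — `V` any real vector space, `N, Q : V → ℝ` with `N(t•y) = t²N(y)`, `Q(t•y) = t²Q(y)`, `0 ≤ N`, `N y = 0 → y = 0`; if
  `μ·N(y) ≤ f y` on `{N ≤ R²}` and `∃ σ odd, |f y − f₀ − ½Q(y) − σ y| ≤ B₄·N(y)²` on `{N ≤ R²}`, then `(2μ − 2f₀/R² − 2B₄R²)·N(y) ≤ Q(y)` for EVERY `y`;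
* ★★ `gauge_coercive_of_growth_offset_half` — the tuned form: `2f₀ ≤ μR²/2`, `2B₄R² ≤ μ/2` ⟹ `μ·N(y) ≤ Q(y)`;
* ★ `raySecond_homogeneous` — for `Q y := iteratedDeriv 2 (fun s => f (s • y)) 0` the homogeneity `Q(t•y) = t²Q(y)` holds whenever `s ↦ f(s•y)` is `C²` (Mathlib
  `iteratedDeriv_comp_const_mul`), so `Q` = the RAY SECOND DERIVATIVE is admissible: the conclusion reads `(…)·N(y) ≤ D²f(0)[y,y]` without any Hessian operator.

HONEST LABEL: generic real analysis (Mathlib only); nothing model-side; ⟨24197⟩ ∕ ⟨24196⟩ ∕ ⟨24194⟩ ∕ ⟨24497⟩ OPEN; own crux ⟨22884⟩ OPEN (blocked-on ⟨19935⟩); no crux, rung of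
record or summit is proved; the Yang–Mills mass gap is NOT proved; no summit is proved by a line.  THEOREMS ONLY (0 `def`, 0 `sorry`), standard axioms.
Width seat ym-line-sfw-p2-w3 g65 (cell ym-idea-1, free hands), `--supports stmt-QuantumFields-24197`.  References: [folklore].
-/

set_option autoImplicit false

noncomputable section

open Set Filter Topology

namespace Summit.QuantumFields.YangMills.Theorems.QuantitativeLaplace

variable {V : Type*} [AddCommGroup V] [Module ℝ V]

/-- ★★★ **COERCIVITY FROM ABSOLUTE GROWTH, GAUGE FORM.**  `N, Q : V → ℝ` homogeneous of degree two under real scaling, `N ≥ 0` and definite.  If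
`μ·N(y) ≤ f y` whenever `N y ≤ R²` (`R > 0`) and `∃ σ` ODD with `|f y − f₀ − ½Q(y) − σ y| ≤ B₄·N(y)²` whenever `N y ≤ R²`, then for EVERY `y`
`(2μ − 2f₀/R² − 2B₄R²)·N(y) ≤ Q(y)` (evaluate at `±u` with `N(u) = R²`, add, rescale). [folklore] -/
theorem gauge_coercive_of_growth_offset {N Q f : V → ℝ} {μ B₄ R f₀ : ℝ} (hR : 0 < R)
    (hN : ∀ (t : ℝ) (y : V), N (t • y) = t ^ 2 * N y) (hQ : ∀ (t : ℝ) (y : V), Q (t • y) = t ^ 2 * Q y)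
    (hN0 : ∀ y, 0 ≤ N y) (hNdef : ∀ y, N y = 0 → y = 0)
    (hgrowth : ∀ y : V, N y ≤ R ^ 2 → μ * N y ≤ f y)
    (hT : ∃ σ : V → ℝ, (∀ y, σ (-y) = -σ y) ∧ ∀ y : V, N y ≤ R ^ 2 → |f y - f₀ - (1 / 2) * Q y - σ y| ≤ B₄ * N y ^ 2)
    (y : V) : (2 * μ - 2 * f₀ / R ^ 2 - 2 * B₄ * R ^ 2) * N y ≤ Q y := by
  obtain ⟨σ, hσ, hrem⟩ := hT
  have hQ0 : Q 0 = 0 := by have h := hQ 0 y; rw [zero_smul] at h; simpa using h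
  by_cases hy : N y = 0
  · have : y = 0 := hNdef y hy
    subst this; rw [hy, hQ0]; simp
  have hNy : 0 < N y := lt_of_le_of_ne (hN0 y) (Ne.symm hy)
  -- the rescaled vector `u = t • y`, `t = R/√(N y)`, with `N u = R²`
  set t : ℝ := R / Real.sqrt (N y) with ht
  have hsq : 0 < Real.sqrt (N y) := Real.sqrt_pos.2 hNy
  have ht0 : 0 < t := div_pos hR hsq
  have ht2 : t ^ 2 * N y = R ^ 2 := by
    rw [ht, div_pow, Real.sq_sqrt hNy.le, div_mul_cancel₀ _ hNy.ne']
  have hNu : N (t • y) = R ^ 2 := by rw [hN, ht2]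
  have hNu' : N (-(t • y)) = R ^ 2 := by rw [show -(t • y) = (-1 : ℝ) • (t • y) by simp, hN, hNu]; norm_num
  have hQu : Q (t • y) = t ^ 2 * Q y := hQ t y
  have hQu' : Q (-(t • y)) = t ^ 2 * Q y := by rw [show -(t • y) = (-1 : ℝ) • (t • y) by simp, hQ, hQu]; norm_num
  have h1 := hrem (t • y) hNu.le
  have h2 := hrem (-(t • y)) hNu'.le
  have g1 := hgrowth (t • y) hNu.le
  have g2 := hgrowth (-(t • y)) hNu'.le
  rw [hσ] at h2
  rw [hQu, hNu] at h1
  rw [hQu', hNu'] at h2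
  rw [hNu] at g1
  rw [hNu'] at g2
  have s1 := (abs_le.1 h1).2
  have s2 := (abs_le.1 h2).2
  -- `2μR² ≤ 2f₀ + t²Q(y) + 2B₄R⁴`
  have hsum : 2 * μ * R ^ 2 ≤ 2 * f₀ + t ^ 2 * Q y + 2 * B₄ * (R ^ 2) ^ 2 := by linarith
  have hR2 : 0 < R ^ 2 := by positivity
  have key : t ^ 2 * ((2 * μ - 2 * f₀ / R ^ 2 - 2 * B₄ * R ^ 2) * N y) ≤ t ^ 2 * Q y := by
    have e : t ^ 2 * ((2 * μ - 2 * f₀ / R ^ 2 - 2 * B₄ * R ^ 2) * N y) = (2 * μ - 2 * f₀ / R ^ 2 - 2 * B₄ * R ^ 2) * R ^ 2 := by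
      rw [← ht2]; ring
    rw [e]
    have e2 : (2 * μ - 2 * f₀ / R ^ 2 - 2 * B₄ * R ^ 2) * R ^ 2 = 2 * μ * R ^ 2 - 2 * f₀ - 2 * B₄ * (R ^ 2) ^ 2 := by
      field_simp
    rw [e2]
    linarith
  exact le_of_mul_le_mul_left key (by positivity)

/-- ★★ **The tuned form**: if `2·f₀ ≤ μ·R²/2` and `2·B₄·R² ≤ μ/2` then `μ·N(y) ≤ Q(y)` for every `y`. [folklore] -/
theorem gauge_coercive_of_growth_offset_half {N Q f : V → ℝ} {μ B₄ R f₀ : ℝ} (hR : 0 < R)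
    (hN : ∀ (t : ℝ) (y : V), N (t • y) = t ^ 2 * N y) (hQ : ∀ (t : ℝ) (y : V), Q (t • y) = t ^ 2 * Q y)
    (hN0 : ∀ y, 0 ≤ N y) (hNdef : ∀ y, N y = 0 → y = 0)
    (hgrowth : ∀ y : V, N y ≤ R ^ 2 → μ * N y ≤ f y)
    (hT : ∃ σ : V → ℝ, (∀ y, σ (-y) = -σ y) ∧ ∀ y : V, N y ≤ R ^ 2 → |f y - f₀ - (1 / 2) * Q y - σ y| ≤ B₄ * N y ^ 2)
    (hsmall₁ : 2 * f₀ ≤ μ * R ^ 2 / 2) (hsmall₂ : 2 * B₄ * R ^ 2 ≤ μ / 2)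
    (y : V) : μ * N y ≤ Q y := by
  have h := gauge_coercive_of_growth_offset hR hN hQ hN0 hNdef hgrowth hT y
  have hR2 : 0 < R ^ 2 := by positivity
  have h1 : 2 * f₀ / R ^ 2 ≤ μ / 2 := by rw [div_le_iff₀ hR2]; linarith
  have hcoef : μ ≤ 2 * μ - 2 * f₀ / R ^ 2 - 2 * B₄ * R ^ 2 := by linarith
  exact le_trans (mul_le_mul_of_nonneg_right hcoef (hN0 y)) h

/-! ## The ray second derivative is an admissible `Q` -/

section Ray

variable {W : Type*} [AddCommGroup W] [Module ℝ W]

/-- ★ **Homogeneity of the ray second derivative**: if `s ↦ f(s•y)` is `C²` for every `y`, then `Q y := (d²/ds²) f(s•y)|₀` satisfies `Q(t•y) = t²·Q(y)`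
(Mathlib `iteratedDeriv_comp_const_mul`). [folklore] -/
theorem raySecond_homogeneous {f : W → ℝ} (hf : ∀ y : W, ContDiff ℝ 2 (fun s : ℝ => f (s • y))) (t : ℝ) (y : W) :
    iteratedDeriv 2 (fun s : ℝ => f (s • (t • y))) 0 = t ^ 2 * iteratedDeriv 2 (fun s : ℝ => f (s • y)) 0 := by
  have e : (fun s : ℝ => f (s • (t • y))) = fun s : ℝ => (fun r : ℝ => f (r • y)) (t * s) := by
    funext s; simp only [smul_smul, mul_comm s t]
  rw [e, iteratedDeriv_comp_const_mul (hf y) t]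
  simp only [mul_zero]

/-- The ray second derivative is EVEN: `Q(−y) = Q(y)` (case `t = −1`). [folklore] -/
theorem raySecond_neg {f : W → ℝ} (hf : ∀ y : W, ContDiff ℝ 2 (fun s : ℝ => f (s • y))) (y : W) :
    iteratedDeriv 2 (fun s : ℝ => f (s • -y)) 0 = iteratedDeriv 2 (fun s : ℝ => f (s • y)) 0 := by
  have h := raySecond_homogeneous hf (-1) y
  rw [neg_one_smul] at h
  rw [h]; norm_num

end Ray

end Summit.QuantumFields.YangMills.Theorems.QuantitativeLaplace

end
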